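import Summits.RiemannHypothesis.RiemannHypothesis.Theorems.PfPersistenceThetaIntegral
import Summits.RiemannHypothesis.RiemannHypothesis.Theorems.PfPersistenceInWindowMirrorOdd
import Summits.RiemannHypothesis.RiemannHypothesis.Theorems.PfPersistenceParityMassLawOdd
import HarnessLib

/-!
# PF-persistence cell — THE ODD AUTOCORRELATION IDENTITY AND THE ODD FAR-LAG SIGN LEMMA

Framing (page 1): mechanism/rigidity campaign; no RH claims.  Every `theorem` below is PROVED (kernel-checked,
RH-free, weight-free: any `Weights`, any window); the words DATA / CONJECTURE in docstrings mark what is NOT proved here.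
This is part 1 of the ODD-sector (G1.02) companion of the even level-drop law `PfPersistenceAutocorrSplitLaw`
(06a91c08df81); part 2 (`PfPersistenceAutocorrSplitOdd`) turns it into the far-lag level-drop law for the odd readers.

* §1 `thetaOdd_eq_integral`: Connes' odd correlation function `θ⁻_{nm}(y)` (`n, m ≥ 1`) IS the windowed autocorrelation
  `∫_{-L/2}^{L/2-y} ξ⁻_n(x) ξ⁻_m(x+y) dx` of the sine modes `ξ⁻_n = xiOdd L n` (companion of `thetaEven_eq_integral`).
* §2 hence the odd one-prime pattern form is the odd profile's autocorrelation `A⁻_v(log p) = oddAutocorr (2a) v (log p)`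
  (`oddPrimePattern_form_eq_oddAutocorr`), and along the odd `p`-dial
  `vᵀQ⁻(dial p K w)v = vᵀQ⁻(w)v − 2(K−1)·w(p)·A⁻_v(log p)` (`form_oddBlock_dial_eq_oddAutocorr`).
* §3 THE ODD FAR-LAG SIGN LEMMA: a profile that is odd (`θ⁻(−x) = −θ⁻(x)`, automatic for `profileOdd`) and one-signed on
  the half window `H = [0, L/2]` has `A⁻_v(y) ≤ 0` at every FAR lag `L/2 ≤ y ≤ L` — on the integration range
  `x ≤ 0 ≤ x + y`, so the integrand is `−θ⁻(−x)θ⁻(x+y) ≤ 0` (`oddAutocorr_nonpos_of_oneSignedOdd_far`); with a `φ`-floor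
  (`FloorOneSignedOdd`), `A⁻_u(y) ≤ 2φN‖u‖²` (`oddAutocorr_le_of_floorOneSignedOdd_far`).

At NEAR lags `y < L/2` the odd autocorrelation of a one-signed-on-`H` profile has no sign a priori (not covered; DATA only).
-/

set_option linter.dupNamespace false

noncomputable section

namespace Summit.RiemannHypothesis.RiemannHypothesis.Theorems.PfPersistence

open Real intervalIntegral MeasureTheory Matrix BigOperators Finset
open Summit.RiemannHypothesis.RiemannHypothesis.Theorems.PfPersistenceParityTransfer (thetaOdd)

/-! ## §1 The integral representation of `thetaOdd` -/

/-- PROVED: `ξ⁻_n(u − L/2) = √(2/L)·sin(2πnu/L)` — the `(−1)^n` makes the odd modes plain sines on `[0, L]`. [folklore] -/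
theorem xiOdd_sub_half {L : ℝ} (hL : L ≠ 0) (n : ℕ) (u : ℝ) :
    xiOdd L n (u - L / 2) = Real.sqrt (2 / L) * Real.sin (2 * π * n * u / L) := by
  have harg : 2 * π * n * (u - L / 2) / L = 2 * π * n * u / L - n * π := by
    field_simp
  simp only [xiOdd]
  rw [harg, Real.sin_sub_nat_mul_pi]
  have h1 : ((-1 : ℝ) ^ n) * (-1) ^ n = 1 := by
    rw [← mul_pow]; norm_num
  calc (-1 : ℝ) ^ n * Real.sqrt (2 / L) * ((-1) ^ n * Real.sin (2 * π * n * u / L))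
        = ((-1 : ℝ) ^ n * (-1) ^ n) * (Real.sqrt (2 / L) * Real.sin (2 * π * n * u / L)) := by ring
    _ = Real.sqrt (2 / L) * Real.sin (2 * π * n * u / L) := by rw [h1, one_mul]

/-- PROVED: the translated odd mode in the shifted coordinate, `ξ⁻_m(u − L/2 + y) = √(2/L)·sin((2πm/L)u + 2πmy/L)`. [folklore] -/
theorem xiOdd_sub_half_add {L : ℝ} (hL : L ≠ 0) (m : ℕ) (u y : ℝ) :
    xiOdd L m (u - L / 2 + y) = Real.sqrt (2 / L) * Real.sin (2 * π * m / L * u + 2 * π * m * y / L) := by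
  rw [show u - L / 2 + y = (u + y) - L / 2 by ring, xiOdd_sub_half hL]
  congr 1; congr 1; ring

/-- The odd correlation integral in the shifted coordinate. [folklore] -/
theorem thetaOdd_integral_shift (L y : ℝ) (n m : ℕ) :
    ∫ x in (-(L / 2))..(L / 2 - y), xiOdd L n x * xiOdd L m (x + y)
      = ∫ u in (0:ℝ)..(L - y), xiOdd L n (u - L / 2) * xiOdd L m (u - L / 2 + y) :=
  integral_shift_half (fun x => xiOdd L n x * xiOdd L m (x + y)) L y

/-- Case `n = m` (any `n ≠ 0`). [folklore] -/
theorem thetaOdd_integral_diag {L : ℝ} (hL : 0 < L) {n : ℕ} (hn : n ≠ 0) (y : ℝ) :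
    ∫ x in (-(L / 2))..(L / 2 - y), xiOdd L n x * xiOdd L n (x + y)
      = (L - y) / L * Real.cos (2 * π * n * y / L) + Real.sin (2 * π * n * y / L) / (2 * π * n) := by
  have hL0 : L ≠ 0 := hL.ne'
  have hnR : (n : ℝ) ≠ 0 := Nat.cast_ne_zero.2 hn
  have hc : 4 * π * n / L ≠ 0 := by positivity
  have hf : (fun u => xiOdd L n (u - L / 2) * xiOdd L n (u - L / 2 + y))
      = fun u => (1 / L) * Real.cos (2 * π * n * y / L)
          + (-(1 / L)) * Real.cos (4 * π * n / L * u + 2 * π * n * y / L) := by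
    funext u
    rw [xiOdd_sub_half hL0 n, xiOdd_sub_half_add hL0 n]
    have hprod : 2 * (Real.sin (2 * π * n * u / L) * Real.sin (2 * π * n / L * u + 2 * π * n * y / L))
        = Real.cos (2 * π * n * u / L - (2 * π * n / L * u + 2 * π * n * y / L))
          - Real.cos (2 * π * n * u / L + (2 * π * n / L * u + 2 * π * n * y / L)) := by
      rw [← mul_assoc]; exact Real.two_mul_sin_mul_sin _ _
    have hA : 2 * π * n * u / L - (2 * π * n / L * u + 2 * π * n * y / L) = -(2 * π * n * y / L) := by ring
    have hB : 2 * π * n * u / L + (2 * π * n / L * u + 2 * π * n * y / L)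
        = 4 * π * n / L * u + 2 * π * n * y / L := by ring
    rw [hA, hB, Real.cos_neg] at hprod
    have hsq := sqrt_two_div_mul hL
    calc Real.sqrt (2 / L) * Real.sin (2 * π * n * u / L)
          * (Real.sqrt (2 / L) * Real.sin (2 * π * n / L * u + 2 * π * n * y / L))
        = (Real.sqrt (2 / L) * Real.sqrt (2 / L)) / 2
          * (2 * (Real.sin (2 * π * n * u / L) * Real.sin (2 * π * n / L * u + 2 * π * n * y / L))) := by
            ring
      _ = (2 / L) / 2 * (Real.cos (2 * π * n * y / L)
          - Real.cos (4 * π * n / L * u + 2 * π * n * y / L)) := by rw [hsq, hprod]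
      _ = _ := by ring
  have hi1 : IntervalIntegrable (fun u : ℝ => (1 / L) * Real.cos (2 * π * n * y / L)) volume 0 (L - y) :=
    intervalIntegrable_const
  have hi2 : IntervalIntegrable
      (fun u : ℝ => (-(1 / L)) * Real.cos (4 * π * n / L * u + 2 * π * n * y / L)) volume 0 (L - y) :=
    (by fun_prop : Continuous fun u : ℝ =>
      (-(1 / L)) * Real.cos (4 * π * n / L * u + 2 * π * n * y / L)).intervalIntegrable _ _
  rw [thetaOdd_integral_shift, hf, intervalIntegral.integral_add hi1 hi2, intervalIntegral.integral_const,
    intervalIntegral.integral_const_mul, integral_cos_linear hc, smul_eq_mul]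
  have e1 : 4 * π * n / L * (L - y) + 2 * π * n * y / L = ((2 * n : ℕ) : ℝ) * (2 * π) - 2 * π * n * y / L := by
    push_cast; field_simp; ring
  rw [e1, Real.sin_nat_mul_two_pi_sub, mul_zero, zero_add]
  field_simp
  ring

/-- Case `n ≠ m`, both nonzero. [folklore] -/
theorem thetaOdd_integral_offdiag {L : ℝ} (hL : 0 < L) {n m : ℕ} (hn : n ≠ 0) (hm : m ≠ 0) (hnm : n ≠ m)
    (y : ℝ) :
    ∫ x in (-(L / 2))..(L / 2 - y), xiOdd L n x * xiOdd L m (x + y)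
      = ((m : ℝ) * Real.sin (2 * π * n * y / L) - (n : ℝ) * Real.sin (2 * π * m * y / L)) /
          (π * ((m : ℝ) ^ 2 - (n : ℝ) ^ 2)) := by
  have hL0 : L ≠ 0 := hL.ne'
  have hnR : (n : ℝ) ≠ 0 := Nat.cast_ne_zero.2 hn
  have hmR : (m : ℝ) ≠ 0 := Nat.cast_ne_zero.2 hm
  have hnmR : (n : ℝ) - m ≠ 0 := sub_ne_zero.2 (Nat.cast_injective.ne hnm)
  have hnmR' : (n : ℝ) + m ≠ 0 := by positivity
  have hsqR : (m : ℝ) ^ 2 - (n : ℝ) ^ 2 ≠ 0 := by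
    have : (m : ℝ) ^ 2 - (n : ℝ) ^ 2 = -(((n : ℝ) - m) * ((n : ℝ) + m)) := by ring
    rw [this]; exact neg_ne_zero.2 (mul_ne_zero hnmR hnmR')
  have hc1 : 2 * π * ((n : ℝ) - m) / L ≠ 0 := by
    refine div_ne_zero (mul_ne_zero (by positivity) hnmR) hL0
  have hc2 : 2 * π * ((n : ℝ) + m) / L ≠ 0 := by positivity
  have hf : (fun u => xiOdd L n (u - L / 2) * xiOdd L m (u - L / 2 + y))
      = fun u => (1 / L) * Real.cos (2 * π * ((n : ℝ) - m) / L * u + -(2 * π * m * y / L))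
          + (-(1 / L)) * Real.cos (2 * π * ((n : ℝ) + m) / L * u + 2 * π * m * y / L) := by
    funext u
    rw [xiOdd_sub_half hL0 n, xiOdd_sub_half_add hL0 m]
    have hprod : 2 * (Real.sin (2 * π * n * u / L) * Real.sin (2 * π * m / L * u + 2 * π * m * y / L))
        = Real.cos (2 * π * n * u / L - (2 * π * m / L * u + 2 * π * m * y / L))
          - Real.cos (2 * π * n * u / L + (2 * π * m / L * u + 2 * π * m * y / L)) := by
      rw [← mul_assoc]; exact Real.two_mul_sin_mul_sin _ _
    have hA : 2 * π * n * u / L - (2 * π * m / L * u + 2 * π * m * y / L)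
        = 2 * π * ((n : ℝ) - m) / L * u + -(2 * π * m * y / L) := by ring
    have hB : 2 * π * n * u / L + (2 * π * m / L * u + 2 * π * m * y / L)
        = 2 * π * ((n : ℝ) + m) / L * u + 2 * π * m * y / L := by ring
    rw [hA, hB] at hprod
    have hsq := sqrt_two_div_mul hL
    calc Real.sqrt (2 / L) * Real.sin (2 * π * n * u / L)
          * (Real.sqrt (2 / L) * Real.sin (2 * π * m / L * u + 2 * π * m * y / L))
        = (Real.sqrt (2 / L) * Real.sqrt (2 / L)) / 2
          * (2 * (Real.sin (2 * π * n * u / L) * Real.sin (2 * π * m / L * u + 2 * π * m * y / L))) := by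
            ring
      _ = (2 / L) / 2 * (Real.cos (2 * π * ((n : ℝ) - m) / L * u + -(2 * π * m * y / L))
          - Real.cos (2 * π * ((n : ℝ) + m) / L * u + 2 * π * m * y / L)) := by rw [hsq, hprod]
      _ = _ := by ring
  have hi1 : IntervalIntegrable
      (fun u : ℝ => (1 / L) * Real.cos (2 * π * ((n : ℝ) - m) / L * u + -(2 * π * m * y / L))) volume 0 (L - y) :=
    (by fun_prop : Continuous fun u : ℝ =>
      (1 / L) * Real.cos (2 * π * ((n : ℝ) - m) / L * u + -(2 * π * m * y / L))).intervalIntegrable _ _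
  have hi2 : IntervalIntegrable
      (fun u : ℝ => (-(1 / L)) * Real.cos (2 * π * ((n : ℝ) + m) / L * u + 2 * π * m * y / L)) volume 0 (L - y) :=
    (by fun_prop : Continuous fun u : ℝ =>
      (-(1 / L)) * Real.cos (2 * π * ((n : ℝ) + m) / L * u + 2 * π * m * y / L)).intervalIntegrable _ _
  rw [thetaOdd_integral_shift, hf, intervalIntegral.integral_add hi1 hi2, intervalIntegral.integral_const_mul,
    intervalIntegral.integral_const_mul, integral_cos_linear hc1, integral_cos_linear hc2]
  have e1 : 2 * π * ((n : ℝ) - m) / L * (L - y) + -(2 * π * m * y / L)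
      = (((n : ℤ) - m : ℤ) : ℝ) * (2 * π) - 2 * π * n * y / L := by
    push_cast; field_simp; ring
  have e2 : 2 * π * ((n : ℝ) + m) / L * (L - y) + 2 * π * m * y / L
      = ((n + m : ℕ) : ℝ) * (2 * π) - 2 * π * n * y / L := by
    push_cast; field_simp; ring
  rw [e1, e2, Real.sin_int_mul_two_pi_sub, Real.sin_nat_mul_two_pi_sub, mul_zero, zero_add, mul_zero,
    zero_add, Real.sin_neg]
  field_simp
  ring

/-- **PROVED — INTEGRAL REPRESENTATION OF `thetaOdd`.** For `0 < L`, `n, m ≥ 1` and every real `y`,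
`θ⁻_{nm}(y) = ∫_{-L/2}^{L/2-y} ξ⁻_n(x) ξ⁻_m(x+y) dx`: Connes' odd correlation function IS the windowed autocorrelation
of the sine modes (companion of `thetaEven_eq_integral`). [folklore] -/
theorem thetaOdd_eq_integral {L : ℝ} (hL : 0 < L) {n m : ℕ} (hn : n ≠ 0) (hm : m ≠ 0) (y : ℝ) :
    thetaOdd L n m y = ∫ x in (-(L / 2))..(L / 2 - y), xiOdd L n x * xiOdd L m (x + y) := by
  by_cases hnm : n = m
  · subst hnm
    rw [thetaOdd_integral_diag hL hn]; simp [thetaOdd]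
  · rw [thetaOdd_integral_offdiag hL hn hm hnm]; simp [thetaOdd, hnm]

/-! ## §2 The odd pattern form is the odd profile's autocorrelation -/

/-- the windowed AUTOCORRELATION of the ODD profile `θ⁻_v` at lag `y`: `∫_{-L/2}^{L/2-y} θ⁻_v(x) θ⁻_v(x+y) dx`. -/
def oddAutocorr (L : ℝ) {N : ℕ} (v : Fin N → ℝ) (y : ℝ) : ℝ :=
  ∫ x in (-(L / 2))..(L / 2 - y), profileOdd L v x * profileOdd L v (x + y)

/-- PROVED: `v ⬝ᵥ (M v) = Σ_i Σ_j v_i M_{ij} v_j`, any dimension. [folklore] -/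
theorem dotProduct_mulVec_eq_sum_fin {n : ℕ} (M : Matrix (Fin n) (Fin n) ℝ) (v : Fin n → ℝ) :
    v ⬝ᵥ (M *ᵥ v) = ∑ i, ∑ j, v i * M i j * v j := by
  simp only [dotProduct, Matrix.mulVec, Finset.mul_sum, mul_assoc]

/-- **PROVED**: the `θ⁻`-kernel quadratic form is the odd windowed autocorrelation,
`Σ_i Σ_j v_i θ⁻_{i+1,j+1}(y) v_j = ∫_{-L/2}^{L/2-y} θ⁻_v(x) θ⁻_v(x+y) dx`. [folklore] -/
theorem sum_thetaOdd_eq_oddAutocorr {L : ℝ} (hL : 0 < L) {N : ℕ} (v : Fin N → ℝ) (y : ℝ) :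
    ∑ i : Fin N, ∑ j : Fin N, v i * thetaOdd L ((i : ℕ) + 1) ((j : ℕ) + 1) y * v j = oddAutocorr L v y := by
  unfold oddAutocorr
  have hint : ∀ x, profileOdd L v x * profileOdd L v (x + y)
      = ∑ i : Fin N, ∑ j : Fin N, v i * v j * (xiOdd L ((i : ℕ) + 1) x * xiOdd L ((j : ℕ) + 1) (x + y)) := by
    intro x; unfold profileOdd; rw [Finset.sum_mul_sum]
    exact Finset.sum_congr rfl fun i _ => Finset.sum_congr rfl fun j _ => by ring
  simp_rw [hint]
  rw [intervalIntegral.integral_finsetSum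
    (f := fun (i : Fin N) x => ∑ j : Fin N, v i * v j * (xiOdd L ((i : ℕ) + 1) x * xiOdd L ((j : ℕ) + 1) (x + y)))
    (fun i _ => Continuous.intervalIntegrable (by unfold xiOdd; fun_prop) _ _)]
  refine Finset.sum_congr rfl fun i _ => ?_
  rw [intervalIntegral.integral_finsetSum
    (f := fun (j : Fin N) x => v i * v j * (xiOdd L ((i : ℕ) + 1) x * xiOdd L ((j : ℕ) + 1) (x + y)))
    (fun j _ => Continuous.intervalIntegrable (by unfold xiOdd; fun_prop) _ _)]
  refine Finset.sum_congr rfl fun j _ => ?_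
  rw [intervalIntegral.integral_const_mul, ← thetaOdd_eq_integral hL (Nat.succ_ne_zero _) (Nat.succ_ne_zero _)]
  ring

/-- **PROVED**: the ODD ONE-PRIME PATTERN FORM is the odd autocorrelation at lag `log p`:
`v ⬝ᵥ (oddPrimePattern p win · v) = ∫ θ⁻_v(x) θ⁻_v(x + log p) dx`. [folklore] -/
theorem oddPrimePattern_form_eq_oddAutocorr {win : Window} (ha : 0 < win.a) (p : ℕ) (v : Fin win.N → ℝ) :
    v ⬝ᵥ (oddPrimePattern p win *ᵥ v) = oddAutocorr (2 * win.a) v (Real.log p) := by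
  rw [dotProduct_mulVec_eq_sum_fin, ← sum_thetaOdd_eq_oddAutocorr (by positivity)]
  simp only [oddPrimePattern]

/-- PROVED: along the odd `p`-dial the form moves by the odd autocorrelation,
`vᵀQ⁻(dial p K w)v = vᵀQ⁻(w)v − 2(K−1)·w(p)·A⁻_v(log p)`. [folklore] -/
theorem form_oddBlock_dial_eq_oddAutocorr {win : Window} {p : ℕ} (hp : p ∈ primeRange (2 * win.a)) (K : ℝ)
    (w : Weights) (v : Fin win.N → ℝ) :
    v ⬝ᵥ (oddBlock (dial p K w) win *ᵥ v)
      = v ⬝ᵥ (oddBlock w win *ᵥ v) - 2 * (K - 1) * w p * oddAutocorr (2 * win.a) v (Real.log p) := by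
  rw [form_oddBlock_dial hp K w v, oddPrimePattern_form_eq_oddAutocorr win.ha]

/-! ## §3 Far lags: the odd autocorrelation of a half-window one-signed profile is `≤ 0` -/

/-- **PROVED — THE ODD FAR-LAG SIGN LEMMA:** if `θ⁻_v` is one-signed on the half window `H = [0, L/2]` then at every FAR
lag `L/2 ≤ y ≤ L` its windowed autocorrelation is `≤ 0`: on the range `[-L/2, L/2 − y]` one has `x ≤ 0 ≤ x + y`, and by
antisymmetry `θ⁻_v(x)θ⁻_v(x+y) = −θ⁻_v(−x)θ⁻_v(x+y)` with both `−x, x+y ∈ H`. [folklore] -/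
theorem oddAutocorr_nonpos_of_oneSignedOdd_far {L : ℝ} {N : ℕ} {v : Fin N → ℝ} (hv : OneSignedOdd L v)
    {y : ℝ} (hy : L / 2 ≤ y) (hyL : y ≤ L) : oddAutocorr L v y ≤ 0 := by
  have hab : -(L / 2) ≤ L / 2 - y := by linarith
  have h : 0 ≤ ∫ x in (-(L / 2))..(L / 2 - y), -(profileOdd L v x * profileOdd L v (x + y)) := by
    apply intervalIntegral.integral_nonneg hab
    intro x hx
    have hs : -x ∈ Set.Icc 0 (L / 2) := ⟨by linarith [hx.2], by linarith [hx.1]⟩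
    have ht : x + y ∈ Set.Icc 0 (L / 2) := ⟨by linarith [hx.1], by linarith [hx.2]⟩
    have hgx : profileOdd L v x = -profileOdd L v (-x) := by rw [profileOdd_neg]; ring
    rw [hgx, neg_mul, neg_neg]
    rcases hv with h | h
    · exact mul_nonneg (h _ hs) (h _ ht)
    · exact mul_nonneg_of_nonpos_of_nonpos (h _ hs) (h _ ht)
  rw [intervalIntegral.integral_neg] at h
  unfold oddAutocorr
  linarith

/-- **PROVED — THE FLOORED ODD FAR-LAG BOUND:** a `φ`-floor one-signed odd profile on `H` (`0 ≤ φ`, `0 < L`) has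
`A⁻_u(y) ≤ 2φN·‖u‖²` at every far lag `L/2 ≤ y ≤ L` (pointwise `−θ⁻_u(−x)θ⁻_u(x+y) ≤ 2φ·(max_H|θ⁻_u|)²` over a range of
length `L − y ≤ L/2`, and `(max_H|θ⁻_u|)²·L ≤ 2N‖u‖²`). [folklore] -/
theorem oddAutocorr_le_of_floorOneSignedOdd_far {L φ : ℝ} (hL : 0 < L) (hφ : 0 ≤ φ) {N : ℕ} {u : Fin N → ℝ}
    (h : FloorOneSignedOdd L φ u) {y : ℝ} (hy : L / 2 ≤ y) (hyL : y ≤ L) :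
    oddAutocorr L u y ≤ 2 * φ * N * (u ⬝ᵥ u) := by
  set M := profileOddMax L u with hMdef
  have hM0 : 0 ≤ M := profileOddMax_nonneg L u
  have hm : 0 ≤ φ * M := mul_nonneg hφ hM0
  -- the elementary floor inequality (the tree's `neg_le_mul_of_floor` / `_ceil`, 06a91c08df81, inlined to keep this
  -- module independent of that one): two reals `≥ −m` (or both `≤ m`), each of size `≤ M`, have product `≥ −2mM`.
  have floor : ∀ a b : ℝ, -(φ * M) ≤ a → -(φ * M) ≤ b → |a| ≤ M → |b| ≤ M → -(2 * (φ * M) * M) ≤ a * b := by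
    intro a b ha hb haM hbM
    have ha' : a ≤ M := (le_abs_self a).trans haM
    have hb' : b ≤ M := (le_abs_self b).trans hbM
    have hmM := mul_nonneg hm hM0
    rcases le_or_gt 0 a with h0a | h0a <;> rcases le_or_gt 0 b with h0b | h0b
    · nlinarith [mul_nonneg h0a h0b]
    · nlinarith [mul_nonneg h0a (by linarith : 0 ≤ b + φ * M), mul_le_mul_of_nonneg_left ha' hm]
    · nlinarith [mul_nonneg h0b (by linarith : 0 ≤ a + φ * M), mul_le_mul_of_nonneg_left hb' hm]
    · nlinarith [mul_pos_of_neg_of_neg h0a h0b]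
  have ceil : ∀ a b : ℝ, a ≤ φ * M → b ≤ φ * M → |a| ≤ M → |b| ≤ M → -(2 * (φ * M) * M) ≤ a * b := by
    intro a b ha hb haM hbM
    have h' := floor (-a) (-b) (by linarith) (by linarith) (by rwa [abs_neg]) (by rwa [abs_neg])
    rwa [neg_mul_neg] at h'
  have hpt : ∀ x ∈ Set.Icc (-(L / 2)) (L / 2 - y),
      profileOdd L u x * profileOdd L u (x + y) ≤ 2 * (φ * M) * M := by
    intro x hx
    have hs : -x ∈ Set.Icc 0 (L / 2) := ⟨by linarith [hx.2], by linarith [hx.1]⟩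
    have ht : x + y ∈ Set.Icc 0 (L / 2) := ⟨by linarith [hx.1], by linarith [hx.2]⟩
    have hgx : profileOdd L u x = -profileOdd L u (-x) := by rw [profileOdd_neg]; ring
    have h1 := abs_profileOdd_le_profileOddMax L u hs
    have h2 := abs_profileOdd_le_profileOddMax L u ht
    have key : -(2 * (φ * M) * M) ≤ profileOdd L u (-x) * profileOdd L u (x + y) := by
      rcases h with h | h
      · exact floor _ _ (h _ hs) (h _ ht) h1 h2
      · exact ceil _ _ (h _ hs) (h _ ht) h1 h2
    rw [hgx, neg_mul]
    linarith
  have hc : Continuous fun x => profileOdd L u x * profileOdd L u (x + y) :=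
    (continuous_profileOdd L u).mul ((continuous_profileOdd L u).comp (continuous_id.add continuous_const))
  have hab : -(L / 2) ≤ L / 2 - y := by linarith
  have hi0 : IntervalIntegrable (fun _ : ℝ => 2 * (φ * M) * M) volume (-(L / 2)) (L / 2 - y) :=
    intervalIntegrable_const
  have hI := intervalIntegral.integral_mono_on hab (hc.intervalIntegrable _ _) hi0 hpt
  rw [intervalIntegral.integral_const, smul_eq_mul] at hI
  have hMsq : M ^ 2 ≤ (u ⬝ᵥ u) * (N * (2 / L)) := profileOddMax_sq_le hL u
  have e : (u ⬝ᵥ u) * (N * (2 / L)) * L = (u ⬝ᵥ u) * (2 * N) := by field_simp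
  have hMsq' : M ^ 2 * L ≤ (u ⬝ᵥ u) * (2 * N) := by
    have := mul_le_mul_of_nonneg_right hMsq hL.le
    rwa [e] at this
  have h2φ : 0 ≤ 2 * φ * M ^ 2 := mul_nonneg (mul_nonneg zero_le_two hφ) (sq_nonneg M)
  have k1 : (L - y) * (2 * φ * M ^ 2) ≤ (L / 2) * (2 * φ * M ^ 2) :=
    mul_le_mul_of_nonneg_right (by linarith) h2φ
  have k2 : φ * (M ^ 2 * L) ≤ φ * ((u ⬝ᵥ u) * (2 * N)) := mul_le_mul_of_nonneg_left hMsq' hφ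
  unfold oddAutocorr
  linarith [hI, k1, k2]


end Summit.RiemannHypothesis.RiemannHypothesis.Theorems.PfPersistence

end
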